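import Summits.BirchSwinnertonDyer.Rank1Residual.Additive.PotentiallyOrdinaryTypeG
import HarnessLib

/-!
# X3♯(G-ord) / X4♯(G-ord): a (G)-ordinary pair is ORDINARY at EVERY place of good reduction above `p` of EVERY number field

HONEST FRAMING (cell `b2b-bsdres`, run/shared/lean/b2b/bsd-rank1-residual/, verbatim in every
file): the goal of the cell is to DELETE the COMBINATION-SHAPED residual classes of the
Birch–Swinnerton-Dyer formula for ALL analytic-rank `≤ 1` elliptic curves over `ℚ` — "full BSD
formula for every rank `≤ 1` curve in class `C`" assembled STRICTLY from published theorems — so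
that the rank-`≤ 1` remainder becomes exactly the CONSTRUCTION-SHAPED classes, which are TYPED
(missing-input `Prop`s), NOT attempted. This is not "finishing BSD". Sub-cell `additive-p2`
(CLASS-OWNERS row "X3/X4 additive — pot. good ordinary / X3♯(G-ord)"), generation 9: research
route; no claim beyond the stated classes; theorems only, no definition, no new named fact;
X3♯(G-ord)/X4♯(G-ord) stay CONSTRUCTION-SHAPED; no label moves.

WHAT THIS FILE DOES. Gen 5 (`GordFieldOrdinary.lean`) proved that a (G)-ordinary additive pair
(`TypeGOrd W p`, `p ≥ 5`) is good ORDINARY at every place above `p` of every SUBFIELD OF `ℚ(ζ_p)`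
over which it is good (residue field `𝔽_p`). The sibling file `PotentiallyOrdinaryTypeG.lean`
(this generation) proved the converse "ordinary somewhere ⟹ (G)-ordinary". Here the forward
direction is freed from `ℚ(ζ_p)`:

* `TypeGOrd.hasUnitRootAt_baseChange` — `TypeGOrd W p`, `E` additive at `p ≥ 5`, `F` ANY number
  field, `w ∋ p` ANY place with `E_F` good at `w` ⟹ `E_F` satisfies the unit-root (ordinary)
  condition at `w`: **ordinarity of a potentially good ordinary pair is independent of the
  semistabilising field and place.**
* `typeGOrd_iff_typeG_and_forall_unitRoot` — `TypeGOrd W p ↔ TypeG W p ∧ (∀ F w, E_F good at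
  w ∋ p → unit root at w)`; with `typeGOrd_iff_exists_good_unitRoot` (sibling file) the three
  readings "(G)-ordinary" / "good ordinary SOMEWHERE above `p`" / "(G) and ordinary EVERYWHERE it
  is good above `p`" coincide in the kernel.

PROOF. Defect `3, 4, 6`: (G) gives `e ∣ p − 1`, so `3 ∣ p − 1` (resp. `4 ∣ p − 1`) while the
reduction at `w` has `j̃ = 0` (resp. `1728`) — ORDINARY over the residue field `𝔽_{p^f}` by
Deuring's criterion in Euler's form (gen 3 `SpecialJ.not_ringChar_dvd_trace_of_j_eq_zero`, which
asks for `C((q−1)/2, (q−1)/3) ≢ 0 (mod p)`; over `𝔽_{p^f}` this is LUCAS's theorem in full,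
proved here by induction on `f` from Mathlib's one-step
`Choose.choose_modEq_choose_mod_mul_choose_div_nat`: `(p^{f+1}−1)/2 = (p−1)/2 + p·(p^f−1)/2`,
`(p^{f+1}−1)/d = (p−1)/d + p·(p^f−1)/d`, and `p ∤ C((p−1)/2, (p−1)/d)` —
`SpecialJ.not_dvd_choose_pow_sub_one_div`). Defect `2`: the twist `E' = E^{(p*)}` is good
ORDINARY at `p` over `ℚ` (gen 4 `exists_goodOrd_twist_pStar_of_typeGOrd`); over `M = F(√p*)`
(Mathlib `SplittingField` of `X² − p*` over `F`) and `𝔓 ∣ w`: `E'_M` is ordinary at `𝔓` (UP from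
`ℚ`), `E'_M ≅ E_M`, and ordinarity DESCENDS from `𝔓` to `w` because `E_F` is good at `w` (gen 4
`hasUnitRootAt_baseChange_iff_of_hasGoodReductionAt`, both directions).

Scope (honest): `p ≥ 5` and `E` additive at `p`; nothing here changes a label or books a pair; the
located gap of the sub-cell (AUDIT-X34-GORD §0) is untouched.

References: M. Deuring, Abh. Math. Sem. Hamburg 14 (1941); É. Lucas, Amer. J. Math. 1 (1878);
J. H. Silverman, *AEC* V.2.3.1, V.4.1(a), Ex. V.4.4–4.5, VII.5.4–5.5, X.2; D. Delbourgo, Compositio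
Math. 113 (1998) §1.5 (G), Thm. 3; R. Greenberg, LNM 1716 (1999) Thm. 1.2 (unit-root hypothesis).
-/

noncomputable section

open scoped Classical NumberField

open Polynomial WeierstrassCurve IsDedekindDomain IsDedekindDomain.HeightOneSpectrum NumberField
  Rat.HeightOneSpectrum Literature.NumberTheory.EllipticCurves
  Literature.NumberTheory.EllipticCurves.Rank1Residual
  Literature.NumberTheory.EllipticCurves.HasseElementary

namespace Summit.BirchSwinnertonDyer.Rank1Residual.Additive

namespace SpecialJ

/-! ### Lucas in full: `p ∤ C((p^f−1)/2, (p^f−1)/d)` for `2 ≤ d`, `d ∣ p − 1` -/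

/-- `p ∤ C(a, b)` for `b ≤ a < p` (`C(a,b)·b!·(a−b)! = a!` and `p ∤ a!`). -/
theorem not_dvd_choose_of_lt {p a b : ℕ} (hp : p.Prime) (hba : b ≤ a) (hap : a < p) :
    ¬ p ∣ a.choose b := by
  intro h
  have hfac : p ∣ a.factorial := by
    rw [← Nat.choose_mul_factorial_mul_factorial hba, mul_assoc]
    exact dvd_mul_of_dvd_left h _
  exact absurd ((Nat.Prime.dvd_factorial hp).mp hfac) (not_le.mpr hap)

/-- `p^{f+1} − 1 = (p − 1) + p (p^f − 1)`. -/
theorem pow_succ_sub_one_eq {p : ℕ} (hp : 0 < p) (f : ℕ) :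
    p ^ (f + 1) - 1 = (p - 1) + p * (p ^ f - 1) := by
  have hp1 : 1 ≤ p := hp
  have h1 : 1 ≤ p ^ f := Nat.one_le_pow _ _ hp
  have h2 : 1 ≤ p ^ (f + 1) := Nat.one_le_pow _ _ hp
  zify [hp1, h1, h2]
  ring

/-- `(p^{f+1} − 1)/d = (p−1)/d + p·(p^f − 1)/d` for `d ∣ p − 1` (the base-`p` digit recursion of
the special arguments of Lucas's theorem). -/
theorem pow_succ_sub_one_div {p d : ℕ} (hp : 0 < p) (hdp : d ∣ p - 1) (f : ℕ) :
    (p ^ (f + 1) - 1) / d = (p - 1) / d + p * ((p ^ f - 1) / d) := by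
  have hdf : d ∣ p ^ f - 1 := dvd_trans hdp (Nat.sub_one_dvd_pow_sub_one p f)
  rw [pow_succ_sub_one_eq hp f, Nat.add_div_of_dvd_right hdp, Nat.mul_div_assoc _ hdf]

/-- **Lucas, in full, for the special binomials**: for an odd prime `p`, `2 ≤ d`, `d ∣ p − 1` and
every `f`, `p ∤ C((p^f − 1)/2, (p^f − 1)/d)` — the base-`p` digits of the two arguments are
constantly `(p−1)/2` and `(p−1)/d ≤ (p−1)/2`. Induction on `f` with Mathlib's one-step
`Choose.choose_modEq_choose_mod_mul_choose_div_nat`. -/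
theorem not_dvd_choose_pow_sub_one_div {p d : ℕ} [hp : Fact p.Prime] (hp2 : p ≠ 2) (hd2 : 2 ≤ d)
    (hd : d ∣ p - 1) (f : ℕ) : ¬ p ∣ ((p ^ f - 1) / 2).choose ((p ^ f - 1) / d) := by
  induction f with
  | zero =>
    simp only [pow_zero, Nat.sub_self, Nat.zero_div, Nat.choose_self]
    exact hp.out.not_dvd_one
  | succ f ih =>
    have hp0 : 0 < p := hp.out.pos
    have h2p : 2 ∣ p - 1 := by
      obtain ⟨k, hk⟩ := hp.out.odd_of_ne_two hp2
      exact ⟨k, by omega⟩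
    rw [pow_succ_sub_one_div hp0 h2p, pow_succ_sub_one_div hp0 hd]
    intro hdvd
    have ha : (p - 1) / 2 < p := by omega
    have hb : (p - 1) / d < p := lt_of_le_of_lt (Nat.div_le_self _ _) (by omega)
    have hL := Choose.choose_modEq_choose_mod_mul_choose_div_nat
      (n := (p - 1) / 2 + p * ((p ^ f - 1) / 2)) (k := (p - 1) / d + p * ((p ^ f - 1) / d))
      (p := p)
    rw [Nat.add_mul_mod_self_left, Nat.add_mul_mod_self_left, Nat.mod_eq_of_lt ha,
      Nat.mod_eq_of_lt hb, Nat.add_mul_div_left _ _ hp0, Nat.add_mul_div_left _ _ hp0,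
      Nat.div_eq_of_lt ha, Nat.div_eq_of_lt hb, zero_add, zero_add] at hL
    have h0 := hL.symm.trans (Nat.modEq_zero_iff_dvd.mpr hdvd)
    rcases (Nat.Prime.dvd_mul hp.out).mp (Nat.modEq_zero_iff_dvd.mp h0) with h | h
    · exact not_dvd_choose_of_lt hp.out (Nat.div_le_div_left hd2 two_pos) ha h
    · exact ih h

variable {F : Type*} [Field F] [Fintype F] {p : ℕ} [hp : Fact p.Prime]

omit hp in
/-- For a finite field of odd characteristic, `⌊q/2⌋ = (q−1)/2`. -/
theorem card_div_two_eq (hF : ringChar F ≠ 2) :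
    Fintype.card F / 2 = (Fintype.card F - 1) / 2 := by
  have := card_eq_two_mul_add_one hF
  omega

/-- **`C(⌊q/2⌋, (q−1)/3) ≠ 0` in a finite field of characteristic `p ≡ 1 (mod 3)`** (`p` odd):
the binomial hypothesis of gen 3's `not_ringChar_dvd_trace_of_j_eq_zero` holds over EVERY
`𝔽_{p^f}`, not only over `𝔽_p`. -/
theorem natCast_choose_third_ne_zero (hchar : ringChar F = p) (hp2 : p ≠ 2) (h3 : 3 ∣ p - 1) :
    (((Fintype.card F / 2).choose ((Fintype.card F - 1) / 3) : ℕ) : F) ≠ 0 := by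
  have hF : ringChar F ≠ 2 := by rw [hchar]; exact hp2
  haveI : CharP F p := ringChar.of_eq hchar
  obtain ⟨n, -, hn⟩ := FiniteField.card F p
  intro h
  have hdvd : p ∣ (Fintype.card F / 2).choose ((Fintype.card F - 1) / 3) :=
    (CharP.cast_eq_zero_iff F p _).mp h
  rw [card_div_two_eq hF, hn] at hdvd
  exact not_dvd_choose_pow_sub_one_div hp2 (by norm_num) h3 n hdvd

/-- **`C(⌊q/2⌋, (q−1)/4) ≠ 0` in a finite field of characteristic `p ≡ 1 (mod 4)`.** -/
theorem natCast_choose_quarter_ne_zero (hchar : ringChar F = p) (hp2 : p ≠ 2) (h4 : 4 ∣ p - 1) :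
    (((Fintype.card F / 2).choose ((Fintype.card F - 1) / 4) : ℕ) : F) ≠ 0 := by
  have hF : ringChar F ≠ 2 := by rw [hchar]; exact hp2
  haveI : CharP F p := ringChar.of_eq hchar
  obtain ⟨n, -, hn⟩ := FiniteField.card F p
  intro h
  have hdvd : p ∣ (Fintype.card F / 2).choose ((Fintype.card F - 1) / 4) :=
    (CharP.cast_eq_zero_iff F p _).mp h
  rw [card_div_two_eq hF, hn] at hdvd
  exact not_dvd_choose_pow_sub_one_div hp2 (by norm_num) h4 n hdvd

omit hp in
/-- `d ∣ p − 1 ⟹ d ∣ q − 1` for `q = #F` a power of the characteristic `p`. -/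
theorem dvd_card_sub_one_of_dvd (hchar : ringChar F = p) {d : ℕ} (hd : d ∣ p - 1) :
    d ∣ Fintype.card F - 1 := by
  haveI : CharP F p := ringChar.of_eq hchar
  obtain ⟨n, -, hn⟩ := FiniteField.card F p
  rw [hn]
  exact dvd_trans hd (Nat.sub_one_dvd_pow_sub_one p (n : ℕ))

end SpecialJ

/-! ### Ordinary reduction with `j̃ ∈ {0, 1728}` over a residue field of ANY degree -/

section Residue

variable {F : Type*} [Field F] [NumberField F] (V : WeierstrassCurve F) [V.IsElliptic]
  (w : HeightOneSpectrum (𝓞 F)) {p : ℕ}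

/-- **Good reduction with `j ≡ 0` above `p ≥ 5`, `p ≡ 1 (mod 3)`, is ORDINARY — at ANY place of
ANY number field** (gen 3's `hasUnitRootAt_of_valuation_j_lt_one` without its residue-degree-one
hypothesis `N(w) = p`; the binomial non-vanishing over `𝔽_{p^f}` is
`SpecialJ.natCast_choose_third_ne_zero`). Silverman *AEC* V.4.1(a), Ex. V.4.4. -/
theorem hasUnitRootAt_of_valuation_j_lt_one_of_three_dvd (hp : p.Prime) (hp5 : 5 ≤ p)
    (h3 : 3 ∣ p - 1) (hpw : (p : 𝓞 F) ∈ w.asIdeal) (hgood : V.HasGoodReductionAt w)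
    (hj : w.valuation F V.j < 1) : V.HasUnitRootAt w := by
  haveI : Fact p.Prime := ⟨hp⟩
  haveI : (V.reductionAt w).IsElliptic := isElliptic_reductionAt hgood
  letI := Fintype.ofFinite (IsLocalRing.ResidueField (w.adicCompletionIntegers F))
  have hchar := ringChar_residueField_eq w hp hpw
  rw [WeierstrassCurve.hasUnitRootAt_iff, hchar, Nat.card_eq_fintype_card]
  have h := SpecialJ.not_ringChar_dvd_trace_of_j_eq_zero (V.reductionAt w) (by rw [hchar]; omega)
    (by rw [hchar]; omega) (reductionAt_j_eq_zero V w hgood hj)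
    (SpecialJ.dvd_card_sub_one_of_dvd hchar h3)
    (SpecialJ.natCast_choose_third_ne_zero hchar (by omega) h3)
  rwa [hchar] at h

/-- **Good reduction with `j ≡ 1728` above `p ≥ 5`, `p ≡ 1 (mod 4)`, is ORDINARY — at ANY place of
ANY number field.** Silverman *AEC* V.4.1(a), Ex. V.4.5. -/
theorem hasUnitRootAt_of_valuation_j_sub_lt_one_of_four_dvd (hp : p.Prime) (hp5 : 5 ≤ p)
    (h4 : 4 ∣ p - 1) (hpw : (p : 𝓞 F) ∈ w.asIdeal) (hgood : V.HasGoodReductionAt w)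
    (hj : w.valuation F (V.j - 1728) < 1) : V.HasUnitRootAt w := by
  haveI : Fact p.Prime := ⟨hp⟩
  haveI : (V.reductionAt w).IsElliptic := isElliptic_reductionAt hgood
  letI := Fintype.ofFinite (IsLocalRing.ResidueField (w.adicCompletionIntegers F))
  have hchar := ringChar_residueField_eq w hp hpw
  rw [WeierstrassCurve.hasUnitRootAt_iff, hchar, Nat.card_eq_fintype_card]
  have h := SpecialJ.not_ringChar_dvd_trace_of_j_eq (V.reductionAt w) (by rw [hchar]; omega)
    (by rw [hchar]; omega) (reductionAt_j_eq_of_valuation_lt_one V w hgood hj)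
    (SpecialJ.dvd_card_sub_one_of_dvd hchar h4)
    (SpecialJ.natCast_choose_quarter_ne_zero hchar (by omega) h4)
  rwa [hchar] at h

end Residue

/-! ### (G)-ordinary ⟹ ordinary at every good place above `p` of every number field -/

section Main

variable (W : WeierstrassCurve ℚ) [W.IsElliptic] [W.IsGloballyMinimal] (p : ℕ) [hp : Fact p.Prime]

/-- **Defect `3, 4, 6`: type (G) alone gives ordinary reduction wherever `E` becomes good above `p`**
(`p ≥ 5`, `E` additive at `p`, ANY number field `F`, ANY place `w ∋ p`). Gen 5's
`hasUnitRootAt_of_typeG_of_semistabilityIndex_ne_two` without the restriction `F ⊆ ℚ(ζ_p)`. -/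
theorem hasUnitRootAt_baseChange_of_typeG_of_semistabilityIndex_ne_two (hp5 : 5 ≤ p)
    (hadd : Addv W p) (hG : TypeG W p) (hne2 : semistabilityIndex W p ≠ 2)
    {F : Type*} [Field F] [NumberField F] {w : HeightOneSpectrum (𝓞 F)}
    (hw : (p : 𝓞 F) ∈ w.asIdeal) (hgood : (W.baseChange F).HasGoodReductionAt w) :
    (W.baseChange F).HasUnitRootAt w := by
  haveI : (W.baseChange F).IsElliptic := by rw [baseChange]; infer_instance
  have hj : 0 ≤ padicValRat p W.j := padicValRat_j_nonneg_of_typeG W p hG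
  have hdvd : semistabilityIndex W p ∣ p - 1 :=
    ((typeG_iff_not_subM_and_semistabilityIndex_dvd W p hp5).mp hG).2
  have hjF : (W.baseChange F).j = algebraMap ℚ F W.j := W.map_j (algebraMap ℚ F)
  rcases semistabilityIndex_mem_of_addv W p hp5 hadd hj with he | he | he | he
  · exact absurd he hne2
  · -- `e = 3`: `3 ∤ ord_p Δ_min`, `j ≡ 0`, `3 ∣ p − 1`
    have h3v : ¬ 3 ∣ padicValInt p W.minimalDiscriminantInt := by
      intro h
      have := semistabilityIndex_dvd_four_of_three_dvd W p h
      rw [he] at this; omega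
    refine hasUnitRootAt_of_valuation_j_lt_one_of_three_dvd (W.baseChange F) w hp.out hp5
      (by rw [← he]; exact hdvd) hw hgood ?_
    rw [hjF]
    exact valuation_algebraMap_lt_one_of_padicValRat_pos p w hw
      (j_eq_zero_or_padicValRat_j_pos_of_not_three_dvd W p hj h3v)
  · -- `e = 4`: `2 ∤ ord_p Δ_min`, `j ≡ 1728`, `4 ∣ p − 1`
    have h2v : ¬ 2 ∣ padicValInt p W.minimalDiscriminantInt := by
      intro h
      have := semistabilityIndex_dvd_six_of_two_dvd W p h
      rw [he] at this; omega
    have hjF' : (W.baseChange F).j - 1728 = algebraMap ℚ F (W.j - 1728) := by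
      rw [map_sub, hjF, map_ofNat]
    refine hasUnitRootAt_of_valuation_j_sub_lt_one_of_four_dvd (W.baseChange F) w hp.out hp5
      (by rw [← he]; exact hdvd) hw hgood ?_
    rw [hjF']
    exact valuation_algebraMap_lt_one_of_padicValRat_pos p w hw
      ((j_eq_or_padicValRat_j_sub_pos_of_not_two_dvd W p hp5 hj h2v).imp
        (fun h ↦ sub_eq_zero.mpr h) id)
  · -- `e = 6`: `3 ∤ ord_p Δ_min`, `j ≡ 0`, `3 ∣ 6 ∣ p − 1`
    have h3v : ¬ 3 ∣ padicValInt p W.minimalDiscriminantInt := by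
      intro h
      have := semistabilityIndex_dvd_four_of_three_dvd W p h
      rw [he] at this; omega
    refine hasUnitRootAt_of_valuation_j_lt_one_of_three_dvd (W.baseChange F) w hp.out hp5
      (dvd_trans (by norm_num) (he ▸ hdvd)) hw hgood ?_
    rw [hjF]
    exact valuation_algebraMap_lt_one_of_padicValRat_pos p w hw
      (j_eq_zero_or_padicValRat_j_pos_of_not_three_dvd W p hj h3v)

/-- **Defect `2`: a (G)-ordinary pair is ordinary wherever `E` becomes good above `p`** (`p ≥ 5`,
ANY number field `F`, ANY `w ∋ p`): the good ORDINARY twist `E' = E^{(p*)}` over `ℚ` (gen 4), UP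
to `M = F(√p*)` at a place `𝔓 ∣ w`, ACROSS `E'_M ≅ E_M`, DOWN from `𝔓` to `w` since `E_F` is good
at `w`. Gen 5's `hasUnitRootAt_of_typeGOrd_of_semistabilityIndex_eq_two` without `F ⊆ ℚ(ζ_p)`. -/
theorem hasUnitRootAt_baseChange_of_typeGOrd_of_semistabilityIndex_eq_two (hp5 : 5 ≤ p)
    (hG : TypeGOrd W p) (he : semistabilityIndex W p = 2)
    {F : Type} [Field F] [NumberField F] {w : HeightOneSpectrum (𝓞 F)}
    (hw : (p : 𝓞 F) ∈ w.asIdeal) (hgood : (W.baseChange F).HasGoodReductionAt w) :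
    (W.baseChange F).HasUnitRootAt w := by
  haveI : (W.baseChange F).IsElliptic := by rw [baseChange]; infer_instance
  obtain ⟨Wd, iWd, iWdmin, C₀, hC₀, hord⟩ := exists_goodOrd_twist_pStar_of_typeGOrd W p hp5 hG he
  set d : ℚ := (-1 : ℚ) ^ (p / 2) * p with hd
  have hd0 : d ≠ 0 :=
    mul_ne_zero (pow_ne_zero _ (by norm_num)) (by exact_mod_cast hp.out.ne_zero)
  -- the quadratic extension `M = F(√d)`
  let f : F[X] := X ^ 2 - Polynomial.C (algebraMap ℚ F d)
  let M : Type := f.SplittingField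
  haveI : NumberField M := NumberField.of_module_finite F M
  have hdeg : (f.map (algebraMap F M)).degree ≠ 0 := by
    simp only [f, Polynomial.map_sub, Polynomial.map_pow, map_X, map_C]
    rw [degree_X_pow_sub_C (by norm_num)]
    norm_num
  obtain ⟨g, hg⟩ := (SplittingField.splits f).exists_eval_eq_zero hdeg
  have hg2 : (algebraMap ℚ M) d = 1 * g ^ 2 := by
    simp only [f, Polynomial.map_sub, Polynomial.map_pow, map_X, map_C, eval_sub, eval_pow, eval_X,
      eval_C, sub_eq_zero] at hg
    rw [IsScalarTower.algebraMap_apply ℚ F M, hg, one_mul]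
  have hg0 : g ≠ 0 := by
    intro h0
    have : (algebraMap ℚ M) d = 0 := by rw [hg2, h0]; simp
    rw [map_eq_zero] at this
    exact hd0 this
  -- a place `𝔓` of `M` above `w`, and the place `v` of `ℚ` over `p`
  haveI := w.isMaximal
  obtain ⟨Q, hQmax, hQover⟩ :=
    Ideal.exists_maximal_ideal_liesOver_of_isIntegral (S := 𝓞 M) w.asIdeal
  set 𝔓 : HeightOneSpectrum (𝓞 M) :=
    ⟨Q, hQmax.isPrime, Ideal.ne_bot_of_liesOver_of_ne_bot w.ne_bot Q⟩ with h𝔓def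
  haveI h𝔓w' : 𝔓.asIdeal.LiesOver w.asIdeal := hQover
  have h𝔓w : 𝔓.asIdeal.under (𝓞 F) = w.asIdeal := hQover.over.symm
  have hp𝔓 : (p : 𝓞 M) ∈ 𝔓.asIdeal := by
    have : (p : 𝓞 F) ∈ 𝔓.asIdeal.under (𝓞 F) := by rw [h𝔓w]; exact hw
    rw [Ideal.under_def, Ideal.mem_comap, map_natCast] at this
    exact this
  set v : HeightOneSpectrum (𝓞 ℚ) := (primesEquiv (R := 𝓞 ℚ)).symm ⟨p, hp.out⟩ with hvdef
  have hpv : (p : 𝓞 ℚ) ∈ v.asIdeal :=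
    (natCast_mem_asIdeal_iff_eq_primesEquiv_symm v hp.out).mpr rfl
  have h𝔓v : 𝔓.asIdeal.under (𝓞 ℚ) = v.asIdeal := under_eq_asIdeal_of_natCast_mem p 𝔓 hp𝔓
  haveI : 𝔓.asIdeal.LiesOver v.asIdeal := ⟨h𝔓v.symm⟩
  -- UP from `ℚ`: `Wd_M` good with unit root at `𝔓`
  have hgDv : Wd.HasGoodReductionAt v := hasGoodReductionAt_of_hasGoodReductionAtPrime p Wd hord.1
  have huDv : Wd.HasUnitRootAt v :=
    (Wd.hasUnitRootAt_iff_not_dvd_frobeniusTrace v hp.out hpv).mpr hord.2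
  have huDM : (Wd.baseChange M).HasUnitRootAt 𝔓 :=
    (hasUnitRootAt_baseChange_iff_of_hasGoodReductionAt Wd M p hpv h𝔓v hgDv).mpr huDv
  -- `E_M` good at `𝔓` (up from `F`)
  have hWM : (W.baseChange F).baseChange M = W.baseChange M := by
    rw [baseChange, show algebraMap F M = (IsScalarTower.toAlgHom ℚ F M : F →+* M) from rfl]
    exact W.map_baseChange (IsScalarTower.toAlgHom ℚ F M)
  have hgWM : (W.baseChange M).HasGoodReductionAt 𝔓 := by
    rw [← hWM]
    exact hasGoodReductionAt_baseChange_of_hasGoodReductionAt (W.baseChange F) M w 𝔓 hgood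
  -- ACROSS: `Wd_M ≅ W_M`
  have htw : (W.quadraticTwist d).baseChange M = (W.baseChange M).quadraticTwist (1 * g ^ 2) := by
    rw [← hg2]
    exact map_quadraticTwist W (algebraMap ℚ M) d
  haveI : NeZero (2 : M) := ⟨two_ne_zero⟩
  haveI : (W.baseChange M).IsElliptic := by rw [baseChange]; infer_instance
  obtain ⟨C₁, hC₁⟩ := exists_variableChange_quadraticTwist_one (W.baseChange M)
  obtain ⟨C₂, hC₂⟩ := exists_variableChange_quadraticTwist_mul_sq (W.baseChange M) 1 g hg0
  have hWdM : Wd.baseChange M = (C₀.map (algebraMap ℚ M)) • (W.quadraticTwist d).baseChange M := by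
    rw [← hC₀, baseChange, baseChange, ← map_variableChange]
  have hiso : (C₀.map (algebraMap ℚ M) * (C₂ * C₁)) • W.baseChange M = Wd.baseChange M := by
    rw [mul_smul, mul_smul, hC₁, hC₂, ← htw, hWdM]
  rw [← hiso] at huDM
  have huWM : (W.baseChange M).HasUnitRootAt 𝔓 :=
    (hasUnitRootAt_smul_iff (W.baseChange M) (C₀.map (algebraMap ℚ M) * (C₂ * C₁)) 𝔓 hgWM).mp huDM
  -- DOWN from `𝔓` to `w`: `E_F` is good at `w`
  rw [← hWM] at huWM
  exact (hasUnitRootAt_baseChange_iff_of_hasGoodReductionAt (W.baseChange F) M p hw h𝔓w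
    hgood).mp huWM

/-- **A (G)-ordinary additive pair is ORDINARY at EVERY place of good reduction above `p` of EVERY
number field** (`p ≥ 5`, `W` globally minimal): `TypeGOrd W p`, `Addv W p`, `F` any number field,
`w ∋ p` with `E_F` good at `w` ⟹ `E_F` satisfies the unit-root condition at `w`. The ordinarity of
a potentially good ordinary pair does not depend on the semistabilising field or the place
(generalises gen 5's `TypeGOrd.hasUnitRootAt_of_hasGoodReductionAt`, stated for subfields of
`ℚ(ζ_p)`). -/
theorem TypeGOrd.hasUnitRootAt_baseChange (hp5 : 5 ≤ p) (hG : TypeGOrd W p) (hadd : Addv W p)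
    {F : Type} [Field F] [NumberField F] {w : HeightOneSpectrum (𝓞 F)}
    (hw : (p : 𝓞 F) ∈ w.asIdeal) (hgood : (W.baseChange F).HasGoodReductionAt w) :
    (W.baseChange F).HasUnitRootAt w := by
  by_cases he : semistabilityIndex W p = 2
  · exact hasUnitRootAt_baseChange_of_typeGOrd_of_semistabilityIndex_eq_two W p hp5 hG he hw hgood
  · exact hasUnitRootAt_baseChange_of_typeG_of_semistabilityIndex_ne_two W p hp5 hadd hG.typeG he
      hw hgood

/-- **(G)-ordinary ⟺ (G) ∧ "ordinary wherever good above `p`"** (`p ≥ 5`, `E` additive at `p`):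
`TypeGOrd W p` iff `TypeG W p` and, for EVERY number field `F` and EVERY place `w ∋ p` at which
`E_F` is good, `E_F` has the unit-root condition at `w`. Together with
`typeGOrd_iff_exists_good_unitRoot` (sibling file): good ordinary reduction SOMEWHERE above `p`
⟺ (G)-ordinary ⟺ (G) and ordinary EVERYWHERE it is good above `p`. -/
theorem typeGOrd_iff_typeG_and_forall_unitRoot (hp5 : 5 ≤ p) (hadd : Addv W p) :
    TypeGOrd W p ↔ TypeG W p ∧
      ∀ (F : Type) [Field F] [NumberField F] (w : HeightOneSpectrum (𝓞 F)),
        (p : 𝓞 F) ∈ w.asIdeal → (W.baseChange F).HasGoodReductionAt w →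
          (W.baseChange F).HasUnitRootAt w := by
  refine ⟨fun hG ↦ ⟨hG.typeG, fun F _ _ w hw hgood ↦
    TypeGOrd.hasUnitRootAt_baseChange W p hp5 hG hadd hw hgood⟩, fun ⟨hG, h⟩ ↦ ?_⟩
  obtain ⟨L, iF, iN, iC, F, hF⟩ := hG
  haveI : NumberField F := NumberField.of_module_finite ℚ F
  exact ⟨L, iF, iN, iC, F, fun w hw ↦ ⟨hF w hw, h F w hw (hF w hw)⟩⟩

/-- **Potentially good ordinary SOMEWHERE ⟹ ordinary EVERYWHERE it is good** (`p ≥ 5`, `E` additive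
at `p`): if `E_F` is good with unit root at some `w ∋ p`, then for every number field `F'` and
every `w' ∋ p` with `E_{F'}` good at `w'`, `E_{F'}` has the unit-root condition at `w'`. -/
theorem hasUnitRootAt_baseChange_of_good_unitRoot_baseChange (hp5 : 5 ≤ p) (hadd : Addv W p)
    {F : Type} [Field F] [NumberField F] {w : HeightOneSpectrum (𝓞 F)}
    (hw : (p : 𝓞 F) ∈ w.asIdeal) (hgood : (W.baseChange F).HasGoodReductionAt w)
    (hunit : (W.baseChange F).HasUnitRootAt w)
    {F' : Type} [Field F'] [NumberField F'] {w' : HeightOneSpectrum (𝓞 F')}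
    (hw' : (p : 𝓞 F') ∈ w'.asIdeal) (hgood' : (W.baseChange F').HasGoodReductionAt w') :
    (W.baseChange F').HasUnitRootAt w' :=
  TypeGOrd.hasUnitRootAt_baseChange W p hp5
    (typeGOrd_of_good_unitRoot_baseChange W p hp5 hadd hw hgood hunit) hadd hw' hgood'

end Main

end Summit.BirchSwinnertonDyer.Rank1Residual.Additive

end
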